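import Mathlib

/-!
# The local weighted (cobordant) resolution game on formal hypersurface germs

Folklore infrastructure for the crux `LocalWeightedDrop` of route ResolutionOfSingularities/WeightedInvariant
(item stmt-ResolutionOfSingularities-8899): the crux asks for ONE ordinal rank `ι` on formal germs
`f ∈ k[[x₁,…,x_n]]` (all `n`) which drops at every singular `s`-saturated successor after SOME weighted cobordant
move (a formal coordinate change `θ` and weights `w`, chart `x_i ↦ s^{w_i}(c_i + y_i)` of Włodarczyk's full cobordant
blow-up `B = 𝔸ⁿ⁺¹`, arXiv:2203.03090 §4; Abramovich–Quek–Schober arXiv:2412.16426 Def. 6.1 for the saturation).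
An `∃ ι …` statement of this shape is a WELL-FOUNDEDNESS statement about a positional game (Prover picks the move,
Refuter picks an off-vertex exceptional point whose successor germ is again singular).  This file records the game
in INDUCTIVE form and proves the equivalence of the two formulations, so that partial results ("this germ is won")
can be stated and landed as theorems:

* `IsSingular f` — `f ≠ 0`, `f(0) = 0`, no linear terms; `IsMove θ w` — legal move; `cruxChart w c` — the literal
  chart family of the crux; `IsSuccessor f θ w g` — `g` is a singular `s`-saturated successor of `f` under `(θ, w)`;
* `Won n f` — the inductive winning region: some legal move all of whose singular successors are won;
* `WonBy α n f` — won in rank `≤ α` (ordinal-indexed, by well-founded recursion), `Won ↔ ∃ α, WonBy α`;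
* `exists_rank_of_won` — if every singular germ is won then a rank function with the crux's drop property exists
  (`ι := least α`), and `won_of_rank` — conversely a rank function with the drop property wins every singular germ.

Design: everything is stated over an arbitrary field `k : Type` with the crux's literal quantifier shapes, so that the
crux is `∀ p prime, ∀ k (alg. closed, char p), ∃ ι, (drop property)` and
`(∃ ι, drop property) ↔ ∀ n f, IsSingular f → Won n f` (`hasRank_iff_allWon`; no named `Prop` is introduced for the
rank statement, it is spelled out).  Deliberately NOT here: any specific strategy or invariant (see CobordantChartOneMove,
CobordantChartCone, CobordantArcLemma for one-move wins and forced singular successors).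
-/

namespace Literature.AlgebraicGeometry.Resolution.CobordantGame

open MvPowerSeries

variable (k : Type) [Field k]

/-- A formal germ is SINGULAR (for the game): non-zero, vanishing at the origin, with no linear terms
(`f ∈ 𝔪² ∖ {0}`). [folklore] -/
def IsSingular {n : ℕ} (f : MvPowerSeries (Fin n) k) : Prop :=
  f ≠ 0 ∧ MvPowerSeries.constantCoeff f = 0 ∧ ∀ i, MvPowerSeries.coeff (Finsupp.single i 1) f = 0

/-- A LEGAL MOVE of the local weighted resolution game: a formal coordinate change `θ` (zero constant terms,
invertible linear part) and weights `w` with some `wᵢ > 0` (the weighted centre `V(xᵢ : wᵢ > 0)`). [folklore] -/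
def IsMove {n : ℕ} (θ : Fin n → MvPowerSeries (Fin n) k) (w : Fin n → ℕ) : Prop :=
  (∀ i, MvPowerSeries.constantCoeff (θ i) = 0) ∧
    IsUnit (Matrix.det (Matrix.of fun i j => MvPowerSeries.coeff (Finsupp.single j 1) (θ i))) ∧ ∃ i, 0 < w i

/-- The crux's literal chart family at the exceptional point `c`: `xᵢ ↦ s^{wᵢ}(cᵢ + yᵢ)` for `wᵢ > 0` and
`xᵢ ↦ yᵢ` otherwise (`s = X 0`, `yᵢ = X i.succ`); Włodarczyk's full cobordant blow-up chart. [folklore] -/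
noncomputable def cruxChart {n : ℕ} (w : Fin n → ℕ) (c : Fin n → k) : Fin n → MvPowerSeries (Fin (n + 1)) k :=
  fun i => if 0 < w i then MvPowerSeries.X (0 : Fin (n + 1)) ^ (w i) * (MvPowerSeries.C (c i) + MvPowerSeries.X i.succ)
    else MvPowerSeries.X i.succ

/-- `g` is a SINGULAR SUCCESSOR of `f` under the move `(θ, w)`: for some exceptional point `c` off the vertex and
some `a`, `f(θ)(chart) = sᵃ · g` with `s ∤ g` (the `s`-saturated transform at `c`) and `g ∈ 𝔪²`. [folklore] -/
def IsSuccessor {n : ℕ} (f : MvPowerSeries (Fin n) k) (θ : Fin n → MvPowerSeries (Fin n) k) (w : Fin n → ℕ)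
    (g : MvPowerSeries (Fin (n + 1)) k) : Prop :=
  ∃ (c : Fin n → k) (a : ℕ), (∃ i, 0 < w i ∧ c i ≠ 0) ∧
    MvPowerSeries.subst (cruxChart k w c) (MvPowerSeries.subst θ f) = MvPowerSeries.X (0 : Fin (n + 1)) ^ a * g ∧
    ¬ (MvPowerSeries.X (0 : Fin (n + 1)) ∣ g) ∧
    (MvPowerSeries.constantCoeff g = 0 ∧ ∀ j, MvPowerSeries.coeff (Finsupp.single j 1) g = 0)

/-- The WINNING REGION of the local weighted resolution game (inductive form): `f` is won if some legal move has
all its singular successors won (in one more variable).  A germ with a move without singular successors is won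
outright. [folklore] -/
inductive Won : (n : ℕ) → MvPowerSeries (Fin n) k → Prop
  | move {n : ℕ} {f : MvPowerSeries (Fin n) k} (θ : Fin n → MvPowerSeries (Fin n) k) (w : Fin n → ℕ)
      (hm : IsMove k θ w) (h : ∀ g, IsSuccessor k f θ w g → Won (n + 1) g) : Won n f

/-- `WonBy α n f`: `f` is won with game value `≤ α` — some legal move all of whose singular successors are won with
value `< α`.  Defined by well-founded recursion on the ordinal. [folklore] -/
def WonBy : Ordinal.{0} → (n : ℕ) → MvPowerSeries (Fin n) k → Prop
  | α, n, f => ∃ (θ : Fin n → MvPowerSeries (Fin n) k) (w : Fin n → ℕ), IsMove k θ w ∧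
      ∀ g, IsSuccessor k f θ w g → ∃ (β : Ordinal.{0}) (_ : β < α), WonBy β (n + 1) g
  termination_by α => α

variable {k}

/-- Unfolding of `WonBy`. [folklore] -/
theorem wonBy_iff (α : Ordinal.{0}) {n : ℕ} (f : MvPowerSeries (Fin n) k) :
    WonBy k α n f ↔ ∃ (θ : Fin n → MvPowerSeries (Fin n) k) (w : Fin n → ℕ), IsMove k θ w ∧
      ∀ g, IsSuccessor k f θ w g → ∃ β, β < α ∧ WonBy k β (n + 1) g := by
  rw [WonBy]
  simp only [exists_prop]

/-- `WonBy` is monotone in the ordinal. [folklore] -/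
theorem WonBy.mono {α α' : Ordinal.{0}} (hle : α ≤ α') {n : ℕ} {f : MvPowerSeries (Fin n) k} (h : WonBy k α n f) :
    WonBy k α' n f := by
  rw [wonBy_iff] at h ⊢
  obtain ⟨θ, w, hm, hs⟩ := h
  exact ⟨θ, w, hm, fun g hg => by
    obtain ⟨β, hβ, hW⟩ := hs g hg
    exact ⟨β, lt_of_lt_of_le hβ hle, hW⟩⟩

/-- `WonBy α` implies `Won`. [folklore] -/
theorem WonBy.won {α : Ordinal.{0}} : ∀ {n : ℕ} {f : MvPowerSeries (Fin n) k}, WonBy k α n f → Won k n f := by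
  induction α using WellFoundedLT.induction with
  | ind α ih =>
    intro n f h
    rw [wonBy_iff] at h
    obtain ⟨θ, w, hm, hs⟩ := h
    exact Won.move θ w hm fun g hg => by
      obtain ⟨β, hβ, hW⟩ := hs g hg
      exact ih β hβ hW

/-- `Won` implies `WonBy α` for some ordinal `α` (successors of a germ form a small family, so the supremum of their
values exists in `Ordinal.{0}`). [folklore] -/
theorem Won.exists_wonBy {n : ℕ} {f : MvPowerSeries (Fin n) k} (h : Won k n f) : ∃ α, WonBy k α n f := by
  induction h with
  | move θ w hm hsucc ih =>
    rename_i n f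
    choose αg hαg using ih
    let S := {g : MvPowerSeries (Fin (n + 1)) k // IsSuccessor k f θ w g}
    let F : S → Ordinal.{0} := fun g => αg g.1 g.2 + 1
    refine ⟨iSup F, ?_⟩
    rw [wonBy_iff]
    refine ⟨θ, w, hm, fun g hg => ⟨αg g hg, ?_, hαg g hg⟩⟩
    have hle : F ⟨g, hg⟩ ≤ iSup F := Ordinal.le_iSup F ⟨g, hg⟩
    exact lt_of_lt_of_le (Order.lt_succ (αg g hg)) hle

/-- `Won ↔ ∃ α, WonBy α`. [folklore] -/
theorem won_iff_exists_wonBy {n : ℕ} (f : MvPowerSeries (Fin n) k) : Won k n f ↔ ∃ α, WonBy k α n f :=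
  ⟨Won.exists_wonBy, fun ⟨_, h⟩ => h.won⟩

/-- The LEAST GAME VALUE: the least `α` with `WonBy α n f` (and `0` on germs that are not won). [folklore] -/
noncomputable def leastRank (n : ℕ) (f : MvPowerSeries (Fin n) k) : Ordinal.{0} :=
  sInf {α | WonBy k α n f}

/-- A won germ is won by its least game value. [folklore] -/
theorem wonBy_leastRank {n : ℕ} {f : MvPowerSeries (Fin n) k} (h : Won k n f) : WonBy k (leastRank n f) n f := by
  obtain ⟨α, hα⟩ := h.exists_wonBy
  exact csInf_mem (⟨α, hα⟩ : {α | WonBy k α n f}.Nonempty)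

/-- The least game value is at most any value. [folklore] -/
theorem leastRank_le {α : Ordinal.{0}} {n : ℕ} {f : MvPowerSeries (Fin n) k} (h : WonBy k α n f) :
    leastRank n f ≤ α :=
  csInf_le (OrderBot.bddBelow _) h

/-- RANK EXTRACTION: if every singular germ is won, the least game value is a rank function with the crux's drop
property. [folklore] -/
theorem exists_rank_of_won (h : ∀ (n : ℕ) (f : MvPowerSeries (Fin n) k), IsSingular k f → Won k n f) :
    (∃ ι : (n : ℕ) → MvPowerSeries (Fin n) k → Ordinal.{0}, ∀ (n : ℕ) (f : MvPowerSeries (Fin n) k), IsSingular k f →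
      ∃ (θ : Fin n → MvPowerSeries (Fin n) k) (w : Fin n → ℕ), IsMove k θ w ∧
        ∀ g, IsSuccessor k f θ w g → ι (n + 1) g < ι n f) := by
  refine ⟨leastRank, fun n f hf => ?_⟩
  have hW := wonBy_leastRank (h n f hf)
  rw [wonBy_iff] at hW
  obtain ⟨θ, w, hm, hs⟩ := hW
  refine ⟨θ, w, hm, fun g hg => ?_⟩
  obtain ⟨β, hβ, hWg⟩ := hs g hg
  exact lt_of_le_of_lt (leastRank_le hWg) hβ

/-- A singular successor is a singular germ (it is non-zero because `s` does not divide it). [folklore] -/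
theorem IsSuccessor.isSingular {n : ℕ} {f : MvPowerSeries (Fin n) k} {θ : Fin n → MvPowerSeries (Fin n) k}
    {w : Fin n → ℕ} {g : MvPowerSeries (Fin (n + 1)) k} (h : IsSuccessor k f θ w g) : IsSingular k g := by
  obtain ⟨_, _, _, _, hndvd, hg0, hg1⟩ := h
  refine ⟨?_, hg0, hg1⟩
  rintro rfl
  exact hndvd (dvd_zero _)

/-- WINNING FROM A RANK: a rank function with the drop property wins every singular germ (transfinite induction on
the rank). [folklore] -/
theorem won_of_rank (h : (∃ ι : (n : ℕ) → MvPowerSeries (Fin n) k → Ordinal.{0}, ∀ (n : ℕ) (f : MvPowerSeries (Fin n) k), IsSingular k f →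
      ∃ (θ : Fin n → MvPowerSeries (Fin n) k) (w : Fin n → ℕ), IsMove k θ w ∧
        ∀ g, IsSuccessor k f θ w g → ι (n + 1) g < ι n f)) :
    ∀ (n : ℕ) (f : MvPowerSeries (Fin n) k), IsSingular k f → Won k n f := by
  obtain ⟨ι, hι⟩ := h
  suffices key : ∀ (α : Ordinal.{0}) (n : ℕ) (f : MvPowerSeries (Fin n) k), ι n f = α → IsSingular k f → Won k n f from
    fun n f hf => key _ n f rfl hf
  intro α
  induction α using WellFoundedLT.induction with
  | ind α ih =>
    intro n f hα hf
    obtain ⟨θ, w, hm, hs⟩ := hι n f hf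
    exact Won.move θ w hm fun g hg => ih (ι (n + 1) g) (hα ▸ hs g hg) (n + 1) g rfl hg.isSingular

/-- THE EQUIVALENCE: a rank function with the drop property exists iff every singular germ is in the inductive
winning region. [folklore] -/
theorem hasRank_iff_allWon :
    (∃ ι : (n : ℕ) → MvPowerSeries (Fin n) k → Ordinal.{0}, ∀ (n : ℕ) (f : MvPowerSeries (Fin n) k), IsSingular k f →
      ∃ (θ : Fin n → MvPowerSeries (Fin n) k) (w : Fin n → ℕ), IsMove k θ w ∧
        ∀ g, IsSuccessor k f θ w g → ι (n + 1) g < ι n f) ↔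
    ∀ (n : ℕ) (f : MvPowerSeries (Fin n) k), IsSingular k f → Won k n f :=
  ⟨won_of_rank, exists_rank_of_won⟩

/-- The rank statement unfolded into the crux's literal quantifier shape (`∀ c` off the vertex, `∀ a g`, factorisation,
`s ∤ g`, `g ∈ 𝔪²`), for rewriting the crux `LocalWeightedDrop` field by field. [folklore] -/
theorem hasRank_iff_literal :
    (∃ ι : (n : ℕ) → MvPowerSeries (Fin n) k → Ordinal.{0}, ∀ (n : ℕ) (f : MvPowerSeries (Fin n) k), IsSingular k f →
      ∃ (θ : Fin n → MvPowerSeries (Fin n) k) (w : Fin n → ℕ), IsMove k θ w ∧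
        ∀ g, IsSuccessor k f θ w g → ι (n + 1) g < ι n f) ↔
    ∃ ι : (n : ℕ) → MvPowerSeries (Fin n) k → Ordinal.{0}, ∀ (n : ℕ) (f : MvPowerSeries (Fin n) k),
      (f ≠ 0 ∧ MvPowerSeries.constantCoeff f = 0 ∧ ∀ i, MvPowerSeries.coeff (Finsupp.single i 1) f = 0) →
      ∃ (θ : Fin n → MvPowerSeries (Fin n) k) (w : Fin n → ℕ), (∀ i, MvPowerSeries.constantCoeff (θ i) = 0) ∧
        IsUnit (Matrix.det (Matrix.of fun i j => MvPowerSeries.coeff (Finsupp.single j 1) (θ i))) ∧ (∃ i, 0 < w i) ∧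
        ∀ (c : Fin n → k), (∃ i, 0 < w i ∧ c i ≠ 0) → ∀ (a : ℕ) (g : MvPowerSeries (Fin (n + 1)) k),
          MvPowerSeries.subst (fun i : Fin n => if 0 < w i then
              MvPowerSeries.X (0 : Fin (n + 1)) ^ (w i) * (MvPowerSeries.C (c i) + MvPowerSeries.X i.succ)
            else MvPowerSeries.X i.succ) (MvPowerSeries.subst θ f) = MvPowerSeries.X (0 : Fin (n + 1)) ^ a * g →
          ¬ (MvPowerSeries.X (0 : Fin (n + 1)) ∣ g) →
          (MvPowerSeries.constantCoeff g = 0 ∧ ∀ j, MvPowerSeries.coeff (Finsupp.single j 1) g = 0) →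
          ι (n + 1) g < ι n f := by
  constructor
  · rintro ⟨ι, hι⟩
    refine ⟨ι, fun n f hf => ?_⟩
    obtain ⟨θ, w, ⟨hθ0, hdet, hw⟩, hs⟩ := hι n f hf
    exact ⟨θ, w, hθ0, hdet, hw, fun c hc a g hfac hndvd hsing => hs g ⟨c, a, hc, hfac, hndvd, hsing⟩⟩
  · rintro ⟨ι, hι⟩
    refine ⟨ι, fun n f hf => ?_⟩
    obtain ⟨θ, w, hθ0, hdet, hw, hs⟩ := hι n f hf
    refine ⟨θ, w, ⟨hθ0, hdet, hw⟩, fun g hg => ?_⟩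
    obtain ⟨c, a, hc, hfac, hndvd, hsing⟩ := hg
    exact hs c hc a g hfac hndvd hsing

end Literature.AlgebraicGeometry.Resolution.CobordantGame
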